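import Literature.NumberTheory.Transcendental.FormsAlgebraWedgeProofs
import Literature.Geometry.Kaehler.HodgeStarProofs

/-!
# Graded commutativity of the wedge product (named fact discharged)

Topic: algebra of differential forms (`Literature/NumberTheory/Transcendental/FormsAlgebra.lean`).
This theorems-only companion file discharges the named fact

| named fact of `FormsAlgebra.lean`              | discharged by                                  |
|------------------------------------------------|------------------------------------------------|
| `ContinuousAlternatingMap.WedgeComm 𝕜 V A`     | `ContinuousAlternatingMap.WedgeComm_holds`     |

i.e. for continuous alternating maps `α` of degree `k` and `β` of degree `l` on a normed space `V`
over `𝕜 = ℝ, ℂ` with values in a normed commutative `𝕜`-algebra `A`,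
`β ∧ α = (-1)^{kl} α ∧ β` (up to the reindexing `Fin (k + l) ≃ Fin (l + k)`), for the tree's
concrete `∧` (`ContinuousAlternatingMap.wedge`, shuffle normalisation
`(α ∧ β)(v) = (k! l!)⁻¹ ∑_{σ ∈ 𝔖_{k+l}} sign σ · α(v ∘ σ|₁) β(v ∘ σ|₂)`).

Source. F. W. Warner, *Foundations of Differentiable Manifolds and Lie Groups*, GTM 94 (1983),
2.6(a): "If `u ∈ Λ_k(V)` and `v ∈ Λ_l(V)`, then `u ∧ v ∈ Λ_{k+l}(V)` and
`u ∧ v = (-1)^{kl} v ∧ u`" (left there as an exercise), transported to alternating multilinear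
forms by the algebra isomorphism `Λ(V*) ≅ A(V)` of 2.9(5)–(6) / 2.10(b), under which `∧` becomes
the shuffle product 2.10(b)(2), equal by 2.10(b)(3)–(4) to `(p! q!)⁻¹` times the sum over all of
`𝔖_{p+q}` — the normalisation of `ContinuousAlternatingMap.wedge` (`wedge_apply`). The statement
vendored in `FormsAlgebra.lean` is this identity for `A`-valued forms (`A` commutative), which the
same argument proves; it is not mis-stated.

## Proof

Directly on the shuffle formula (Warner proves 2.6(a) on decomposable elements; for alternating
forms the permutation-sum argument below is the standard one). For `v : Fin (l + k) → V`,
`(β ∧ α)(v) = (l! k!)⁻¹ ∑_{σ ∈ 𝔖_{l+k}} sign σ · β(v ∘ σ|_{first l}) α(v ∘ σ|_{last k})`.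
Let `ρ = r^l ∈ 𝔖_{l+k}` be the `l`-th power of the basic rotation `r = finRotate (l + k)`
(`ρ(x) = x + l mod (l + k)`): it carries the first `k` slots onto the last `k` and the last `l`
onto the first `l` (`finRotate_pow_apply_finCongr_castAdd/natAdd`), so each summand is
`sign σ · α(v ∘ σ ∘ ρ ∘ c|_{first k}) β(v ∘ σ ∘ ρ ∘ c|_{last l})` with `c : Fin (k+l) ≃ Fin (l+k)`
the cast (and `A` commutative). Reindexing `σ ↦ σρ` costs the factor `sign ρ = (-1)^{kl}`
(`Literature.Geometry.Kaehler.HodgeStarAux.sign_finRotate_pow`: `sign r = (-1)^{l+k-1}` and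
`l(l+k-1) ≡ kl (mod 2)`), and conjugating by `c` identifies the remaining sum with the shuffle sum
of `(α ∧ β)(v ∘ c)` (`sum_perm_sign_smul_comp_perm`, `sum_perm_sign_smul_comp_equiv` of
`FormsAlgebraWedgeProofs.lean`).

With `IsSmoothFormWedge_holds`, `MextDerivWedge_holds` (`FormsAlgebraWedgeProofs.lean`) and this
file, the hypothesis class `WedgeFacts I M A` of `FormsAlgebra.lean` reduces to associativity
alone (`wedgeFacts_of_assoc`).

## References

* F. W. Warner, *Foundations of Differentiable Manifolds and Lie Groups*, GTM 94, Springer (1983),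
  2.5 (alternating maps, `sgn π`), 2.6(a) (`u ∧ v = (-1)^{kl} v ∧ u`), 2.10(b), eqs. (2)–(4)
  (the shuffle formula and its full-permutation form).
* R. Bott, L. W. Tu, *Differential Forms in Algebraic Topology*, GTM 82, Springer (1982), §I.1
  (`τ ω = (-1)^{deg τ deg ω} ω τ`).
-/

noncomputable section

open Function

namespace Literature.NumberTheory.Transcendental

/-! ### The block rotation `ρ = (finRotate (l + k))^l` on `Fin (l + k)` -/

section BlockRotation

variable {k l : ℕ}

/-- The `l`-th power of the basic rotation of `Fin (l + k)` moves the first `k` slots onto the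
last `k`: `ρ (c (castAdd l i)) = natAdd l i`, `c : Fin (k + l) ≃ Fin (l + k)` the cast. [folklore] -/
theorem finRotate_pow_apply_finCongr_castAdd (i : Fin k) :
    ((finRotate (l + k)) ^ l) (finCongr (Nat.add_comm k l) (Fin.castAdd l i)) = Fin.natAdd l i := by
  refine Fin.ext ?_
  rw [Literature.Geometry.Kaehler.HodgeStarAux.val_finRotate_pow_apply, finCongr_apply,
    Fin.val_cast, Fin.val_castAdd, Fin.val_natAdd, Nat.mod_eq_of_lt (by omega), Nat.add_comm]

/-- The `l`-th power of the basic rotation of `Fin (l + k)` moves the last `l` slots onto the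
first `l`: `ρ (c (natAdd k j)) = castAdd k j`, `c : Fin (k + l) ≃ Fin (l + k)` the cast. [folklore] -/
theorem finRotate_pow_apply_finCongr_natAdd (j : Fin l) :
    ((finRotate (l + k)) ^ l) (finCongr (Nat.add_comm k l) (Fin.natAdd k j)) = Fin.castAdd k j := by
  refine Fin.ext ?_
  rw [Literature.Geometry.Kaehler.HodgeStarAux.val_finRotate_pow_apply, finCongr_apply,
    Fin.val_cast, Fin.val_natAdd, Fin.val_castAdd, show k + (j : ℕ) + l = (j : ℕ) + (l + k) by omega,
    Nat.add_mod_right, Nat.mod_eq_of_lt (by omega)]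

/-- The sign of the block rotation `(finRotate (l + k))^l` is `(-1)^{kl}` (from
`HodgeStarAux.sign_finRotate_pow`). [folklore] -/
theorem sign_finRotate_pow_eq (k l : ℕ) :
    ((Equiv.Perm.sign ((finRotate (l + k)) ^ l) : ℤˣ) : ℤ) = (-1) ^ (k * l) := by
  rw [Literature.Geometry.Kaehler.HodgeStarAux.sign_finRotate_pow (k := l) (m := k) rfl, Nat.mul_comm]

end BlockRotation

end Literature.NumberTheory.Transcendental

namespace ContinuousAlternatingMap

section WedgeComm

variable {𝕜 : Type*} [RCLike 𝕜] {V : Type*} [NormedAddCommGroup V] [NormedSpace 𝕜 V]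
  {A : Type*} [NormedCommRing A] [NormedAlgebra 𝕜 A]

open Literature.NumberTheory.Transcendental

variable (𝕜 V A) in
/-- **Graded commutativity of the wedge product** (the named fact
`ContinuousAlternatingMap.WedgeComm`, discharged): `β ∧ α = (-1)^{kl} α ∧ β` up to the reindexing
`Fin (k + l) ≃ Fin (l + k)`, for all degrees `k l` and all continuous alternating maps with values
in a normed commutative algebra. Warner (1983), 2.6(a) (`u ∧ v = (-1)^{kl} v ∧ u` in `Λ(V)`), read
on alternating forms through 2.10(b) (2)–(4) (shuffle formula = `(p! q!)⁻¹ ∑_{𝔖_{p+q}}`).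
Proof: reindex the shuffle sum of `β ∧ α` by the block rotation `(finRotate (l + k))^l`, of sign
`(-1)^{kl}`. [cite: WarnerGTM94, 2.6(a); 2.10(b) (2)–(4)] -/
theorem WedgeComm_holds : WedgeComm 𝕜 V A := by
  intro k l α β
  ext v
  rw [smul_apply, domDomCongr_apply, wedge_apply_zsmul, wedge_apply_zsmul]
  simp only [comp_apply]
  -- Step 1: rewrite each summand of `β ∧ α` through the block rotation `ρ`.
  have h1 : ∑ σ : Equiv.Perm (Fin (l + k)), (Equiv.Perm.sign σ : ℤ) •
        (β (fun i ↦ v (σ (Fin.castAdd k i))) * α (fun j ↦ v (σ (Fin.natAdd l j)))) =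
      ∑ σ : Equiv.Perm (Fin (l + k)), (Equiv.Perm.sign σ : ℤ) •
        (α (fun i ↦ v (σ (((finRotate (l + k)) ^ l)
            (finCongr (Nat.add_comm k l) (Fin.castAdd l i))))) *
          β (fun j ↦ v (σ (((finRotate (l + k)) ^ l)
            (finCongr (Nat.add_comm k l) (Fin.natAdd k j)))))) := by
    refine Finset.sum_congr rfl fun σ _ ↦ ?_
    rw [mul_comm]
    simp only [finRotate_pow_apply_finCongr_castAdd, finRotate_pow_apply_finCongr_natAdd]
  -- Step 2: reindex `σ ↦ σρ` (factor `sign ρ`), Step 3: conjugate by the cast `c`.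
  have h2 := sum_perm_sign_smul_comp_perm
    (fun z : Fin (l + k) → V ↦ α (fun i ↦ z (finCongr (Nat.add_comm k l) (Fin.castAdd l i))) *
      β (fun j ↦ z (finCongr (Nat.add_comm k l) (Fin.natAdd k j)))) v ((finRotate (l + k)) ^ l)
  have h3 := sum_perm_sign_smul_comp_equiv (finCongr (Nat.add_comm k l))
    (fun z : Fin (k + l) → V ↦ α (fun i ↦ z (Fin.castAdd l i)) * β (fun j ↦ z (Fin.natAdd k j))) v
  simp only [comp_apply] at h2 h3
  have key : ∀ x : A, ((-1 : ℤ) ^ (k * l)) • x = ((-1 : 𝕜) ^ (k * l)) • x := fun x ↦ by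
    rw [← Int.cast_smul_eq_zsmul 𝕜, Int.cast_pow, Int.cast_neg, Int.cast_one]
  rw [h1, h2, h3, sign_finRotate_pow_eq, key, Nat.mul_comm l.factorial k.factorial]
  exact smul_comm _ _ _

end WedgeComm

end ContinuousAlternatingMap

namespace Literature.NumberTheory.Transcendental

variable {E : Type*} [NormedAddCommGroup E] [NormedSpace ℝ E]
  {H : Type*} [TopologicalSpace H] (I : ModelWithCorners ℝ E H)
  (M : Type*) [TopologicalSpace M] [ChartedSpace H M]
  (A : Type*) [NormedCommRing A] [NormedAlgebra ℝ A]

/-- With `IsSmoothFormWedge_holds`, `MextDerivWedge_holds` and `WedgeComm_holds`, the hypothesis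
class `WedgeFacts I M A` of `FormsAlgebra.lean` reduces to the single pointwise algebraic fact of
associativity of `∧` on the model space. [folklore] -/
theorem wedgeFacts_of_assoc (hassoc : ContinuousAlternatingMap.WedgeAssoc ℝ E A) : WedgeFacts I M A :=
  wedgeFacts_of_assoc_comm (I := I) (M := M) hassoc (ContinuousAlternatingMap.WedgeComm_holds ℝ E A)

end Literature.NumberTheory.Transcendental
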